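import Summits.CriticalPhenomena.CardyFormulaZ2.Theorems.CardyQContinuationIsingJetsConformalStubHarmonicMeasureTransport
import Summits.CriticalPhenomena.CardyFormulaZ2.Theorems.CardyQContinuationIsingJetsConformalStubDiscArcHarmonic
import Literature.Probability.RandomPlanarGeometry.RadoConvergenceProofs
import Literature.Probability.RandomPlanarGeometry.CrossRatioContinuity

/-!
# Crux `IsingJetsConformal`, stub `stub_loopSymmetricLimit_harmonicMeasureAlongSequence`:
# uniform inner/outer radii and a uniform harmonic-measure lower bound along a Radó sequence
# (route `CardyQContinuation`, item stmt-CriticalPhenomena-5560)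

The Chelkak–Smirnov crossing theorem is uniform over quadrilaterals `U` with
`B(z₀, r) ⊆ U ⊆ B(z₀, R)` whose wired arcs have (Perron) harmonic measure `≥ t` seen from `z₀`.
For conformal rectangles `Q n → R` in Radó's sense (boundary loops uniformly, marked points
pointwise) and `z₀ ∈ R` we produce such `r, R, t > 0` valid for all large `n` and all four arcs.

Proof. `r`: a closed disc about `z₀` inside `R` is swallowed by the `Q n`
(`JordanDomain.eventually_subset_carrier`); `R`: `JordanDomain.exists_forall_carrier_subset_ball`.
`t`: normalise Riemann maps `f n : 𝔻 → Q n`, `f : 𝔻 → R` at `z₀`; by Radó's theorem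
(`JordanDomain.rado_tendstoUniformlyOn_holds`, closed-disc form) their Carathéodory extensions
`Φ n → Φ` uniformly on `𝔻̄`, so the circle preimages `ζ n i` of the corners converge to the
(pairwise distinct) preimages `ζ i` of the corners of `R`. The preimage of the arc `(Q n).arc i`
under `Φ n|∂𝔻` is a connected subset of the circle through `ζ n i`, `ζ n (i+1)` (the inverse of
a continuous bijection of the circle onto `∂(Q n)` is continuous), hence contains one of the two
closed arcs between them (`HarmonicMeasureAlongSequence.exp_mem_or_exp_mem`, via a continuous
branch of the argument), and therefore, for large `n`, one of two FIXED closed arcs `J⁺ i`, `J⁻ i`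
strictly inside the two limit arcs. For a fixed arc `J` the explicit disc function of
`stub_loopSymmetricLimit_discArcHarmonic` transported by
`stub_loopSymmetricLimit_harmonicMeasureTransport` bounds `ω_{Q n}(f n 0, arc i) = ω(z₀, arc i)`
below by the positive constant `Re F_J (0)`; `t` is the minimum of these eight constants.

References: Ch. Pommerenke, *Boundary Behaviour of Conformal Maps* (1992), Thm. 2.6, Thm. 2.11;
T. Ransford, *Potential Theory in the Complex Plane* (1995), §4.3. No named fact beyond the
(proved) tree inputs is used.
-/

namespace Summit.CriticalPhenomena.CardyFormulaZ2.Theorems.CardyQContinuation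

open Set Metric Filter Complex
open scoped Topology Real
open Literature.Analysis.Potential Literature.Probability.RandomPlanarGeometry

noncomputable section

namespace HarmonicMeasureAlongSequence

/-! ### Angles on the unit circle -/

/-- A unit complex number is `e^{i arg}`. [folklore] -/
theorem exp_arg_mul_I {u : ℂ} (hu : ‖u‖ = 1) : exp (arg u * I) = u := by
  have h := norm_mul_exp_arg_mul_I u
  rwa [hu, ofReal_one, one_mul] at h

/-- Every point of the unit circle is `e^{iθ}` for some `θ` in the window `[a, a + 2π)`.
[folklore] -/
theorem exists_angle_mem_Ico (a : ℝ) {ζ : ℂ} (hζ : ζ ∈ sphere (0 : ℂ) 1) :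
    ∃ θ ∈ Ico a (a + 2 * π), exp (θ * I) = ζ := by
  have h2 : exp (arg ζ * I) = ζ := exp_arg_mul_I (mem_sphere_zero_iff_norm.1 hζ)
  refine ⟨toIcoMod Real.two_pi_pos a (arg ζ), toIcoMod_mem_Ico _ _ _, ?_⟩
  refine (exp_eq_exp_iff_exists_int.2 ⟨-toIcoDiv Real.two_pi_pos a (arg ζ), ?_⟩).trans h2
  rw [← self_sub_toIcoDiv_zsmul, zsmul_eq_mul]
  push_cast
  ring

/-- **Continuous angles along a convergent sequence of unit vectors.** If `p n → P = e^{iα}` on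
the unit circle then `p n = e^{iα_n}` with `α_n = α + arg (p n / P) → α`. [folklore] -/
theorem exists_angles {p : ℕ → ℂ} {P : ℂ} {α : ℝ} (hp : ∀ n, p n ∈ sphere (0 : ℂ) 1)
    (hPe : exp (α * I) = P) (hpP : Tendsto p atTop (𝓝 P)) :
    ∃ αs : ℕ → ℝ, (∀ n, exp (αs n * I) = p n) ∧ Tendsto αs atTop (𝓝 α) := by
  have hP1 : ‖P‖ = 1 := by rw [← hPe]; exact norm_exp_ofReal_mul_I α
  have hP0 : P ≠ 0 := norm_ne_zero_iff.1 (by rw [hP1]; exact one_ne_zero)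
  have hu : Tendsto (fun n ↦ p n / P) atTop (𝓝 1) := by
    have := hpP.div_const P
    rwa [div_self hP0] at this
  have harg : Tendsto (fun n ↦ arg (p n / P)) atTop (𝓝 0) := by
    have := (continuousAt_arg one_mem_slitPlane).tendsto.comp hu
    rwa [arg_one] at this
  refine ⟨fun n ↦ α + arg (p n / P), fun n ↦ ?_, by simpa using tendsto_const_nhds.add harg⟩
  have h1 : ‖p n / P‖ = 1 := by rw [norm_div, mem_sphere_zero_iff_norm.1 (hp n), hP1, div_one]
  rw [ofReal_add, add_mul, exp_add, hPe, exp_arg_mul_I h1]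
  field_simp

/-- **A connected subset of the circle through two points contains one of the two arcs between
them** (pointwise form). If `S ⊆ ∂𝔻` is preconnected and contains `e^{iα}`, `e^{iβ}` with
`α < θ₁ < β < θ₂ < α + 2π`, then `e^{iθ₁} ∈ S` or `e^{iθ₂} ∈ S`: otherwise the branch
`z ↦ arg (z e^{i(π - θ₂)})` of the argument is continuous on `S`, its image is an interval
containing `α + π - θ₂ < β + π - θ₂`, hence the intermediate value `θ₁ + π - θ₂`, which is only
attained at `e^{iθ₁}`. [folklore] -/
theorem exp_mem_or_exp_mem {S : Set ℂ} (hS : IsPreconnected S) (hS1 : S ⊆ sphere (0 : ℂ) 1)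
    {α β θ₁ θ₂ : ℝ} (hα : exp (α * I) ∈ S) (hβ : exp (β * I) ∈ S) (h₁ : α < θ₁) (h₂ : θ₁ < β)
    (h₃ : β < θ₂) (h₄ : θ₂ < α + 2 * π) : exp (θ₁ * I) ∈ S ∨ exp (θ₂ * I) ∈ S := by
  by_contra h
  push Not at h
  obtain ⟨hθ₁, hθ₂⟩ := h
  set ρ : ℂ := exp (((π - θ₂ : ℝ) : ℂ) * I) with hρ
  have hρ1 : ‖ρ‖ = 1 := norm_exp_ofReal_mul_I _
  have hrot : ∀ t : ℝ, exp (t * I) * ρ = exp (((t + π - θ₂ : ℝ) : ℂ) * I) := fun t ↦ by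
    rw [hρ, ← exp_add]
    congr 1
    push_cast
    ring
  have harg : ∀ t : ℝ, -π < t + π - θ₂ → t + π - θ₂ < π →
      arg (exp (t * I) * ρ) = t + π - θ₂ := fun t ht1 ht2 ↦ by
    rw [hrot, arg_exp_mul_I, toIocMod_eq_self]
    constructor <;> linarith
  have hn1 : ∀ z ∈ S, ‖z * ρ‖ = 1 := fun z hz ↦ by
    rw [norm_mul, mem_sphere_zero_iff_norm.1 (hS1 hz), hρ1, one_mul]
  -- the branch of the argument is continuous on `S`
  have hA : ContinuousOn (fun z ↦ arg (z * ρ)) S := fun z hz ↦ by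
    have hslit : z * ρ ∈ slitPlane := by
      rw [mem_slitPlane_iff_arg]
      refine ⟨fun hargπ ↦ hθ₂ ?_, fun h0 ↦ by simpa [h0] using hn1 z hz⟩
      have hzρ : z * ρ = -1 := by
        rw [← norm_mul_exp_arg_mul_I (z * ρ), hn1 z hz, hargπ, ofReal_one, one_mul, exp_pi_mul_I]
      have h2 : exp (θ₂ * I) * ρ = -1 := by
        rw [hrot, show ((θ₂ + π - θ₂ : ℝ) : ℂ) = (π : ℂ) by push_cast; ring, exp_pi_mul_I]
      have hzeq : z = exp (θ₂ * I) := mul_right_cancel₀ (exp_ne_zero _) (hzρ.trans h2.symm)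
      exact hzeq ▸ hz
    have hm : Continuous fun w : ℂ ↦ w * ρ := by fun_prop
    exact (ContinuousAt.comp_of_eq (continuousAt_arg hslit) hm.continuousAt rfl).continuousWithinAt
  have himg : IsPreconnected ((fun z ↦ arg (z * ρ)) '' S) := hS.image _ hA
  have hαS : α + π - θ₂ ∈ (fun z ↦ arg (z * ρ)) '' S := ⟨_, hα, harg α (by linarith) (by linarith)⟩
  have hβS : β + π - θ₂ ∈ (fun z ↦ arg (z * ρ)) '' S := ⟨_, hβ, harg β (by linarith) (by linarith)⟩
  obtain ⟨z, hz, hzarg⟩ := himg.Icc_subset hαS hβS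
    (show θ₁ + π - θ₂ ∈ Icc (α + π - θ₂) (β + π - θ₂) from ⟨by linarith, by linarith⟩)
  replace hzarg : arg (z * ρ) = θ₁ + π - θ₂ := hzarg
  have hzeq : z * ρ = exp (θ₁ * I) * ρ := by
    rw [← norm_mul_exp_arg_mul_I (z * ρ), hn1 z hz, hzarg, hrot θ₁, ofReal_one, one_mul]
  exact hθ₁ (mul_right_cancel₀ (exp_ne_zero _) hzeq ▸ hz)

/-- **Two fixed test arcs.** If `p n → P`, `q n → Q` on the unit circle with `P ≠ Q`, there are
two closed arcs `{e^{iθ} : θ ∈ [a₁, b₁]}`, `{e^{iθ} : θ ∈ [a₂, b₂]}` (`aⱼ < bⱼ < aⱼ + 2π`; strictly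
inside the two arcs from `P` to `Q`) such that, for all large `n`, every preconnected subset of
the circle containing `p n` and `q n` contains one of them. [folklore] -/
theorem eventually_arc_subset {P Q : ℂ} (hP : P ∈ sphere (0 : ℂ) 1) (hQ : Q ∈ sphere (0 : ℂ) 1)
    (hne : P ≠ Q) {p q : ℕ → ℂ} (hp : ∀ n, p n ∈ sphere (0 : ℂ) 1)
    (hq : ∀ n, q n ∈ sphere (0 : ℂ) 1) (hpP : Tendsto p atTop (𝓝 P))
    (hqQ : Tendsto q atTop (𝓝 Q)) :
    ∃ a₁ b₁ a₂ b₂ : ℝ, a₁ < b₁ ∧ b₁ < a₁ + 2 * π ∧ a₂ < b₂ ∧ b₂ < a₂ + 2 * π ∧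
      ∀ᶠ n in atTop, ∀ S : Set ℂ, IsPreconnected S → S ⊆ sphere 0 1 → p n ∈ S → q n ∈ S →
        (∀ θ ∈ Icc a₁ b₁, exp (θ * I) ∈ S) ∨ (∀ θ ∈ Icc a₂ b₂, exp (θ * I) ∈ S) := by
  have hPe : exp ((arg P : ℝ) * I) = P := exp_arg_mul_I (mem_sphere_zero_iff_norm.1 hP)
  obtain ⟨β, ⟨hαβ, hβα⟩, hQe⟩ := exists_angle_mem_Ico (arg P) hQ
  have hαβ' : arg P < β := lt_of_le_of_ne hαβ fun h ↦ hne (by rw [← hPe, ← hQe, h])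
  obtain ⟨αs, hαs, hαsl⟩ := exists_angles hp hPe hpP
  obtain ⟨βs, hβs, hβsl⟩ := exists_angles hq hQe hqQ
  obtain ⟨κ, hκ, hκ1, hκ2⟩ : ∃ κ : ℝ, 0 < κ ∧ 4 * κ ≤ β - arg P ∧ 4 * κ ≤ arg P + 2 * π - β := by
    refine ⟨min (β - arg P) (arg P + 2 * π - β) / 4, ?_,
      by linarith [min_le_left (β - arg P) (arg P + 2 * π - β)],
      by linarith [min_le_right (β - arg P) (arg P + 2 * π - β)]⟩
    have := lt_min (sub_pos.2 hαβ') (by linarith : 0 < arg P + 2 * π - β)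
    linarith
  refine ⟨arg P + κ, β - κ, β + κ, arg P + 2 * π - κ, by linarith, by linarith, by linarith,
    by linarith, ?_⟩
  have hαe : ∀ᶠ n in atTop, |αs n - arg P| < κ :=
    (Metric.tendsto_nhds.1 hαsl κ hκ).mono fun n hn ↦ by rwa [Real.dist_eq] at hn
  have hβe : ∀ᶠ n in atTop, |βs n - β| < κ :=
    (Metric.tendsto_nhds.1 hβsl κ hκ).mono fun n hn ↦ by rwa [Real.dist_eq] at hn
  filter_upwards [hαe, hβe] with n hαn hβn S hS hS1 hpS hqS
  rw [abs_lt] at hαn hβn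
  rw [← hαs n] at hpS
  rw [← hβs n] at hqS
  by_cases h : ∀ θ ∈ Icc (β + κ) (arg P + 2 * π - κ), exp (θ * I) ∈ S
  · exact Or.inr h
  · push Not at h
    obtain ⟨θ₂, ⟨hθ₂a, hθ₂b⟩, hθ₂S⟩ := h
    refine Or.inl fun θ hθ ↦ (exp_mem_or_exp_mem hS hS1 hpS hqS (θ₁ := θ) (θ₂ := θ₂)
      (by linarith [hθ.1]) (by linarith [hθ.2]) (by linarith) (by linarith)).resolve_right hθ₂S

/-! ### Harmonic measure: a fixed arc of the circle mapped into `A` gives a uniform bound -/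

/-- **Lower bound from a fixed arc** (the disc function of `stub_loopSymmetricLimit_discArcHarmonic`
transported by `stub_loopSymmetricLimit_harmonicMeasureTransport`, evaluated at the centre): for
`a < b < a + 2π` there is `τ > 0` with `τ ≤ ω_D(f 0, A)` for every Jordan domain `D`, Riemann map
`f : 𝔻 → D` with Carathéodory extension `Φ`, and every `A ∋ Φ (e^{iθ})` (`θ ∈ [a, b]`). The
decay hypothesis holds because a circle point `e^{iθ}`, `θ ∈ [a, a + 2π)`, with `Φ (e^{iθ}) ∉ A`
has `b < θ`. [folklore] -/
theorem exists_pos_le_harmonicMeasure {a b : ℝ} (hab : a < b) (hba : b < a + 2 * π) :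
    ∃ τ : ℝ, 0 < τ ∧ ∀ (D : JordanDomain) (f : ConformalEquiv (ball (0 : ℂ) 1) D.carrier)
      (Φ : ℂ → ℂ), ContinuousOn Φ (closedBall 0 1) → EqOn Φ f (ball 0 1) →
      BijOn Φ (closedBall 0 1) (closure D.carrier) → BijOn Φ (sphere 0 1) (frontier D.carrier) →
      ∀ A : Set ℂ, (∀ θ ∈ Icc a b, Φ (exp (θ * I)) ∈ A) →
        τ ≤ harmonicMeasure D.carrier (f 0) A := by
  obtain ⟨F, hF, hF01, -, hF0⟩ := stub_loopSymmetricLimit_discArcHarmonic a b hab hba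
  have h0 : (0 : ℂ) ∈ ball (0 : ℂ) 1 := mem_ball_self one_pos
  refine ⟨(F 0).re, (hF01 0 h0).1, fun D f Φ hΦc hΦf hΦbij hΦfr A hA ↦ ?_⟩
  refine stub_loopSymmetricLimit_harmonicMeasureTransport D f Φ hΦc hΦf hΦbij hΦfr A F hF
    (fun w hw ↦ (hF01 w hw).2.le) (fun ζ hζ hζA ε hε ↦ ?_) 0 h0
  obtain ⟨θ, ⟨haθ, hθa⟩, rfl⟩ := exists_angle_mem_Ico a hζ
  have hbθ : b < θ := lt_of_not_ge fun hθb ↦ hζA (hA θ ⟨haθ, hθb⟩)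
  exact (hF0 θ hbθ hθa).eventually (Iio_mem_nhds hε)

/-- **Uniform lower bound for a pair of converging circle points.** If `p n → P ≠ Q ← q n` on the
unit circle, there is `τ > 0` such that for all large `n`: whenever a preconnected subset `S` of
the circle through `p n`, `q n` is mapped into `A` by the Carathéodory extension `Φ` of a Riemann
map `f : 𝔻 → D` of a Jordan domain, `τ ≤ ω_D(f 0, A)` (`S` contains one of the two fixed test
arcs of `eventually_arc_subset`; apply `exists_pos_le_harmonicMeasure` to both). [folklore] -/
theorem exists_pos_eventually_le_of_pair {P Q : ℂ} (hP : P ∈ sphere (0 : ℂ) 1)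
    (hQ : Q ∈ sphere (0 : ℂ) 1) (hne : P ≠ Q) {p q : ℕ → ℂ} (hp : ∀ n, p n ∈ sphere (0 : ℂ) 1)
    (hq : ∀ n, q n ∈ sphere (0 : ℂ) 1) (hpP : Tendsto p atTop (𝓝 P))
    (hqQ : Tendsto q atTop (𝓝 Q)) :
    ∃ τ : ℝ, 0 < τ ∧ ∀ᶠ n in atTop, ∀ (D : JordanDomain)
      (f : ConformalEquiv (ball (0 : ℂ) 1) D.carrier) (Φ : ℂ → ℂ),
      ContinuousOn Φ (closedBall 0 1) → EqOn Φ f (ball 0 1) →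
      BijOn Φ (closedBall 0 1) (closure D.carrier) → BijOn Φ (sphere 0 1) (frontier D.carrier) →
      ∀ A : Set ℂ, (∃ S : Set ℂ, IsPreconnected S ∧ S ⊆ sphere 0 1 ∧ p n ∈ S ∧ q n ∈ S ∧
        ∀ ξ ∈ S, Φ ξ ∈ A) → τ ≤ harmonicMeasure D.carrier (f 0) A := by
  obtain ⟨a₁, b₁, a₂, b₂, h₁, h₁', h₂, h₂', hev⟩ := eventually_arc_subset hP hQ hne hp hq hpP hqQ
  obtain ⟨τ₁, hτ₁, H₁⟩ := exists_pos_le_harmonicMeasure h₁ h₁'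
  obtain ⟨τ₂, hτ₂, H₂⟩ := exists_pos_le_harmonicMeasure h₂ h₂'
  refine ⟨min τ₁ τ₂, lt_min hτ₁ hτ₂, hev.mono fun n hn D f Φ hΦc hΦf hΦbij hΦfr A hA ↦ ?_⟩
  obtain ⟨S, hS, hS1, hpS, hqS, hSA⟩ := hA
  rcases hn S hS hS1 hpS hqS with h | h
  · exact (min_le_left _ _).trans (H₁ D f Φ hΦc hΦf hΦbij hΦfr A fun θ hθ ↦ hSA _ (h θ hθ))
  · exact (min_le_right _ _).trans (H₂ D f Φ hΦc hΦf hΦbij hΦfr A fun θ hθ ↦ hSA _ (h θ hθ))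

/-- **The inverse of the Carathéodory extension on the boundary curve is continuous**: `Φ` is a
continuous bijection of the compact circle onto `∂D`, so `invFunOn Φ ∂𝔻` is continuous on `∂D`
(`tendsto_of_injOn_of_tendsto_comp`). [folklore] -/
theorem continuousOn_invFunOn {Φ : ℂ → ℂ} {D : Set ℂ} (hΦc : ContinuousOn Φ (closedBall 0 1))
    (hΦfr : BijOn Φ (sphere 0 1) (frontier D)) :
    ContinuousOn (Function.invFunOn Φ (sphere 0 1)) (frontier D) := by
  intro z hz
  have hmaps : MapsTo (Function.invFunOn Φ (sphere 0 1)) (frontier D) (sphere 0 1) :=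
    hΦfr.surjOn.mapsTo_invFunOn
  have hright : ∀ x ∈ frontier D, Φ (Function.invFunOn Φ (sphere 0 1) x) = x := fun x hx ↦
    hΦfr.surjOn.rightInvOn_invFunOn hx
  refine tendsto_of_injOn_of_tendsto_comp (isCompact_sphere 0 1)
    (hΦc.mono sphere_subset_closedBall) hΦfr.injOn
    (eventually_mem_nhdsWithin.mono fun x hx ↦ hmaps hx) (hmaps hz) ?_
  rw [hright z hz]
  exact (tendsto_id.mono_left nhdsWithin_le_nhds).congr'
    (eventually_mem_nhdsWithin.mono fun x hx ↦ (hright x hx).symm)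

/-! ### The harmonic-measure bound along a Radó sequence -/

variable {R : ConformalRectangle} {Q : ℕ → ConformalRectangle}

/-- **Uniform harmonic-measure lower bound along a Radó sequence, normalised form** (`z₀` lies in
every `Q n`). Riemann maps normalised at `z₀`, Radó's theorem for the Carathéodory extensions,
convergence of the corner preimages, and `exists_pos_eventually_le_of_pair` applied, for each
`i`, to the connected preimage of `(Q n).arc i` on the circle. [folklore] -/
theorem exists_pos_eventually_le (hJ : TendstoUniformly (fun n ↦ (Q n).boundary) R.boundary atTop)
    (hpt : ∀ i : Fin 4, Tendsto (fun n ↦ (Q n).pt i) atTop (𝓝 (R.pt i))) {z₀ : ℂ}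
    (hz₀ : z₀ ∈ R.carrier) (hz₀n : ∀ n, z₀ ∈ (Q n).carrier) :
    ∃ t : ℝ, 0 < t ∧
      ∀ᶠ n in atTop, ∀ i : Fin 4, t ≤ harmonicMeasure (Q n).carrier z₀ ((Q n).arc i) := by
  classical
  -- normalised Riemann maps `f n : 𝔻 → Q n`, `fl : 𝔻 → R` at `z₀`
  obtain ⟨gl, hgl0, hglre, hglim⟩ := exists_conformalEquiv_ball_deriv_pos R.isOpen
    (JordanDomain.isSimplyConnected_holds R.toJordanDomain) R.carrier_ne_univ hz₀
  choose g hg0 hgre hgim using fun n ↦ exists_conformalEquiv_ball_deriv_pos (Q n).isOpen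
    (JordanDomain.isSimplyConnected_holds (Q n).toJordanDomain) (Q n).carrier_ne_univ (hz₀n n)
  set f : ∀ n, ConformalEquiv (ball (0 : ℂ) 1) (Q n).carrier := fun n ↦ (g n).symm with hf
  set fl : ConformalEquiv (ball (0 : ℂ) 1) R.carrier := gl.symm with hfl
  have hfl0 : fl 0 = z₀ := by
    have := gl.symm_apply_apply hz₀
    rwa [hgl0] at this
  have hf0' : ∀ n, f n 0 = z₀ := fun n ↦ by
    have := (g n).symm_apply_apply (hz₀n n)
    rwa [hg0 n] at this
  have hf0 : ∀ n, f n 0 = fl 0 := fun n ↦ by rw [hf0' n, hfl0]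
  have hfd : ∀ n, 0 < (deriv (f n) 0).re ∧ (deriv (f n) 0).im = 0 := fun n ↦ by
    have h := (g n).deriv_symm_mul_deriv (Q n).isOpen (hz₀n n)
    rw [hg0 n] at h
    exact Rado.re_pos_im_zero_of_mul_eq_one (hgre n) (hgim n) h
  have hfld : 0 < (deriv fl 0).re ∧ (deriv fl 0).im = 0 := by
    have h := gl.deriv_symm_mul_deriv R.isOpen hz₀
    rw [hgl0] at h
    exact Rado.re_pos_im_zero_of_mul_eq_one hglre hglim h
  -- Carathéodory extensions and Radó's theorem on the closed disc
  choose Φ hΦc hΦeq hΦbij hΦsph using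
    fun n ↦ JordanDomain.exists_continuousOn_extension_holds (Q n).toJordanDomain (f n)
  obtain ⟨Φl, hΦlc, hΦleq, hΦlbij, hΦlsph⟩ :=
    JordanDomain.exists_continuousOn_extension_holds R.toJordanDomain fl
  have hrado : TendstoUniformlyOn Φ Φl atTop (closedBall (0 : ℂ) 1) :=
    JordanDomain.rado_tendstoUniformlyOn.closedBall JordanDomain.rado_tendstoUniformlyOn_holds
      (fun n ↦ (Q n).toJordanDomain) R.toJordanDomain f fl hf0 hfd hfld hJ Φ Φl hΦc hΦeq hΦlc hΦleq
  -- the inverse of `Φ n` on the circle and the corner preimages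
  set ψ : ℕ → ℂ → ℂ := fun n ↦ Function.invFunOn (Φ n) (sphere 0 1) with hψ
  have hψs : ∀ n, MapsTo (ψ n) (frontier (Q n).carrier) (sphere 0 1) := fun n ↦
    (hΦsph n).surjOn.mapsTo_invFunOn
  have hΦψ : ∀ n, ∀ x ∈ frontier (Q n).carrier, Φ n (ψ n x) = x := fun n x hx ↦
    (hΦsph n).surjOn.rightInvOn_invFunOn hx
  have hcornerl : ∀ i, ∃ ζ ∈ sphere (0 : ℂ) 1, Φl ζ = R.pt i := fun i ↦
    hΦlsph.surjOn (R.pt_mem_frontier i)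
  choose ζl hζls hΦlζ using hcornerl
  have hζlim : ∀ i, Tendsto (fun n ↦ ψ n ((Q n).pt i)) atTop (𝓝 (ζl i)) := fun i ↦ by
    refine tendsto_of_injOn_of_tendsto_comp (isCompact_closedBall 0 1) hΦlc hΦlbij.injOn
      (Eventually.of_forall fun n ↦ sphere_subset_closedBall (hψs n ((Q n).pt_mem_frontier i)))
      (sphere_subset_closedBall (hζls i)) ?_
    rw [hΦlζ i]
    have h1 : Tendsto (fun n ↦ Φ n (ψ n ((Q n).pt i))) atTop (𝓝 (R.pt i)) :=
      (hpt i).congr fun n ↦ (hΦψ n _ ((Q n).pt_mem_frontier i)).symm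
    refine h1.congr_dist ?_
    rw [Metric.tendsto_nhds]
    intro ε hε
    filter_upwards [Metric.tendstoUniformlyOn_iff.1 hrado ε hε] with n hn
    rw [Real.dist_eq, sub_zero, abs_of_nonneg dist_nonneg, dist_comm]
    exact hn _ (sphere_subset_closedBall (hψs n ((Q n).pt_mem_frontier i)))
  have hζlinj : Function.Injective ζl := fun i j h ↦
    R.pt_injective (by rw [← hΦlζ i, ← hΦlζ j, h])
  have hsucc : ∀ i : Fin 4, i ≠ i + 1 := by decide
  -- the bound, one arc at a time
  have hpair : ∀ i : Fin 4, ∃ τ : ℝ, 0 < τ ∧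
      ∀ᶠ n in atTop, τ ≤ harmonicMeasure (Q n).carrier z₀ ((Q n).arc i) := fun i ↦ by
    obtain ⟨τ, hτ, hev⟩ := exists_pos_eventually_le_of_pair (hζls i) (hζls (i + 1))
      (hζlinj.ne (hsucc i)) (fun n ↦ hψs n ((Q n).pt_mem_frontier i))
      (fun n ↦ hψs n ((Q n).pt_mem_frontier (i + 1))) (hζlim i) (hζlim (i + 1))
    refine ⟨τ, hτ, hev.mono fun n hn ↦ ?_⟩
    have key := hn (Q n).toJordanDomain (f n) (Φ n) (hΦc n) (hΦeq n) (hΦbij n) (hΦsph n)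
      ((Q n).arc i) ⟨ψ n '' (Q n).arc i, ?_, ?_, ⟨_, (Q n).pt_mem_arc_self i, rfl⟩,
        ⟨_, (Q n).pt_succ_mem_arc i, rfl⟩, ?_⟩
    · rwa [hf0' n] at key
    · exact (isPreconnected_Icc.image _ (Q n).continuous_boundary.continuousOn).image _
        ((continuousOn_invFunOn (hΦc n) (hΦsph n)).mono ((Q n).arc_subset_frontier i))
    · rintro _ ⟨x, hx, rfl⟩
      exact hψs n ((Q n).arc_subset_frontier i hx)
    · rintro _ ⟨x, hx, rfl⟩
      rwa [hΦψ n x ((Q n).arc_subset_frontier i hx)]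
  choose τ hτ hτev using hpair
  refine ⟨Finset.univ.inf' Finset.univ_nonempty τ, (Finset.lt_inf'_iff _).2 fun i _ ↦ hτ i,
    eventually_all.2 fun i ↦ (hτev i).mono fun n hn ↦ ?_⟩
  exact (Finset.inf'_le τ (Finset.mem_univ i)).trans hn

/-- **The stub in normalised form**: as `stub_loopSymmetricLimit_harmonicMeasureAlongSequence`,
under the extra hypothesis that `z₀` lies in every `Q n` (inner radius from
`JordanDomain.eventually_subset_carrier`, outer radius from
`JordanDomain.exists_forall_carrier_subset_ball`, `t` from `exists_pos_eventually_le`).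
[folklore] -/
theorem of_forall_mem (hJ : TendstoUniformly (fun n ↦ (Q n).boundary) R.boundary atTop)
    (hpt : ∀ i : Fin 4, Tendsto (fun n ↦ (Q n).pt i) atTop (𝓝 (R.pt i))) {z₀ : ℂ}
    (hz₀ : z₀ ∈ R.carrier) (hz₀n : ∀ n, z₀ ∈ (Q n).carrier) :
    ∃ r Rad t : ℝ, 0 < r ∧ 0 < Rad ∧ 0 < t ∧ ∀ᶠ n in atTop, ball z₀ r ⊆ (Q n).carrier ∧
      (Q n).carrier ⊆ ball z₀ Rad ∧
      ∀ i : Fin 4, t ≤ harmonicMeasure (Q n).carrier z₀ ((Q n).arc i) := by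
  obtain ⟨ε, hε, hεR⟩ := Metric.isOpen_iff.1 R.isOpen z₀ hz₀
  have hr : ∀ᶠ n in atTop, ball z₀ (ε / 2) ⊆ (Q n).carrier :=
    (JordanDomain.eventually_subset_carrier (D := fun n ↦ (Q n).toJordanDomain)
      (Dlim := R.toJordanDomain) hJ hz₀ hz₀n (isCompact_closedBall z₀ (ε / 2))
      ((closedBall_subset_ball (by linarith)).trans hεR)).mono
      fun n hn ↦ ball_subset_closedBall.trans hn
  obtain ⟨R₀, hR₀, -, hRad⟩ := JordanDomain.exists_forall_carrier_subset_ball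
    (D := fun n ↦ (Q n).toJordanDomain) (Dlim := R.toJordanDomain) hJ
  have hRad' : ∀ᶠ n in atTop, (Q n).carrier ⊆ ball z₀ (R₀ + ‖z₀‖) :=
    hRad.mono fun n hn x hx ↦ by
      have h1 := mem_ball_zero_iff.1 (hn hx)
      rw [mem_ball, dist_eq_norm]
      exact (norm_sub_le x z₀).trans_lt (by linarith)
  obtain ⟨t, ht, hT⟩ := exists_pos_eventually_le hJ hpt hz₀ hz₀n
  exact ⟨ε / 2, R₀ + ‖z₀‖, t, half_pos hε, by positivity, ht, hr.and (hRad'.and hT)⟩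

end HarmonicMeasureAlongSequence

open HarmonicMeasureAlongSequence in
/-- **Stub `stub_loopSymmetricLimit_harmonicMeasureAlongSequence`** of the skeleton of the crux
`IsingJetsConformal` (stmt-CriticalPhenomena-5560): if the conformal rectangles `Q n` converge to
`R` in Radó's sense (boundary loops uniformly, marked points pointwise) and `z₀ ∈ R`, there are
`r, R, t > 0` such that for all large `n`, `B(z₀, r) ⊆ Q n ⊆ B(z₀, R)` and each of the four
boundary arcs of `Q n` has Perron harmonic measure at least `t` seen from `z₀`. The point `z₀`
lies in `Q n` for large `n` (`JordanDomain.eventually_mem_carrier_of_tendstoUniformly`); the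
tail of the sequence is `HarmonicMeasureAlongSequence.of_forall_mem`. [folklore] -/
theorem stub_loopSymmetricLimit_harmonicMeasureAlongSequence : (∀ (R : Literature.Probability.RandomPlanarGeometry.ConformalRectangle) (Q : ℕ → Literature.Probability.RandomPlanarGeometry.ConformalRectangle), TendstoUniformly (fun n ↦ (Q n).boundary) R.boundary Filter.atTop → (∀ i : Fin 4, Filter.Tendsto (fun n ↦ (Q n).pt i) Filter.atTop (nhds (R.pt i))) → ∀ z₀ ∈ R.carrier, ∃ r Rad t : ℝ, 0 < r ∧ 0 < Rad ∧ 0 < t ∧ ∀ᶠ n in Filter.atTop, Metric.ball z₀ r ⊆ (Q n).carrier ∧ (Q n).carrier ⊆ Metric.ball z₀ Rad ∧ ∀ i : Fin 4, t ≤ Literature.Analysis.Potential.harmonicMeasure (Q n).carrier z₀ ((Q n).arc i)) := by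
  intro R Q hJ hpt z₀ hz₀
  obtain ⟨N₀, hN₀⟩ := eventually_atTop.1
    (JordanDomain.eventually_mem_carrier_of_tendstoUniformly
      (D := fun n ↦ (Q n).toJordanDomain) hJ hz₀)
  have hJ' : TendstoUniformly (fun n ↦ (Q (n + N₀)).boundary) R.boundary atTop := by
    rw [Metric.tendstoUniformly_iff] at hJ ⊢
    exact fun ε hε ↦ (tendsto_add_atTop_nat N₀).eventually (hJ ε hε)
  obtain ⟨r, Rad, t, hr, hRad, ht, hev⟩ := of_forall_mem (Q := fun n ↦ Q (n + N₀)) hJ'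
    (fun i ↦ (hpt i).comp (tendsto_add_atTop_nat N₀)) hz₀
    (fun n ↦ hN₀ (n + N₀) (Nat.le_add_left _ _))
  refine ⟨r, Rad, t, hr, hRad, ht, ?_⟩
  have hev' : ∀ᶠ n in map (fun a ↦ a + N₀) atTop, ball z₀ r ⊆ (Q n).carrier ∧
      (Q n).carrier ⊆ ball z₀ Rad ∧
      ∀ i : Fin 4, t ≤ harmonicMeasure (Q n).carrier z₀ ((Q n).arc i) :=
    eventually_map.2 hev
  rwa [map_add_atTop_eq_nat] at hev'

end

end Summit.CriticalPhenomena.CardyFormulaZ2.Theorems.CardyQContinuation
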